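/-
Copyright (c) 2026 the pub-hodgecm-mathlib formalisation cell (harness21).  Prover seat hodgecm-mathlib-F0P3a-p01 (g37), FLOOR 0, SUPPORTS-ONLY on h413; β-BOARD v1 R10
(assembler's `hRest` glue, part 1): the Finset re-indexing of the REST SHAPES of (T1) ★ p861261 `OddLabelledBoxSumDefs.IsRestShape`.  2026-09-04.
-/
import Summits.HodgeConjecture.HodgeConjecture.Theorems.F0P3cDyRamOddLabelledBoxSumDefs     -- ★ p861261 (this seat): `IsRestShape`, `restTarget`, `OddLabelledBoxSum`
import Summits.HodgeConjecture.HodgeConjecture.Theorems.F0P3cDyRamOddLabelledBoxReindex      -- ★ p861221 (LH4-p10 (g6)): `sum_box_eq_core_add_hanging_add_towers_add_glued`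
import HarnessLib

/-!
# Crux `H413`, LH4 «(D-RAM) FOUR-FRAME» road, STAGE 1b (β) — THE `hRest` GLUE, PART 1: the box sum over the REST SHAPES is the core-hanging diagonal plus the three
# families of NON-TUBE glued strata (pure `Finset` bookkeeping over `ℚ`, no lattices)

Cell `hodgecm-mathlib` (D-0151), FLOOR 0, crux item H413 = `stmt-HodgeConjecture-24833`, route `HCCMUnconditional`; squad F0∕P3c∕LH4.  THEOREMS ONLY (no `def`, no instance, no
notation, no `sorry`, default heartbeats); lane `--supports stmt-HodgeConjecture-24833 --as helper` (count-neutral; pays NO row).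

WHAT IT SAYS.  For any `v` on axis vectors and any `B`, the indicator sum `Σ_{a : Fin 3 → Fin (B+1)} [IsRestShape d n₁ n₂ n₃ a] · v a` (the LEFT side of (T1)'s binder `hrest` ∕ (T2)'s
hypothesis `hRest`) equals `Σ_{ρ ∈ Icc 1 (B∕2)} v ![2ρ,2ρ,2ρ]` + `Σ_{ρ ∈ Icc 1 (B∕2)} Σ_{s ∈ Icc 1 (B − 2ρ)}` of the three glued families, each cut by `2 ∣ s` and the NEGATION of its
capped-tube read (`2ρ + s + ℓ₀ = n_X ∧ 2ρ + 2 + ℓ₀ ≤ min(other two depths)`).  Proof: ★ p861221 `sum_box_eq_core_add_hanging_add_towers_add_glued` at the weight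
`w a := [IsRestShape a]·v a` (rest shapes lie inside the ★ B3 shape list, so `w` vanishes off it; `w` kills the core and the towers; on the hanging diagonal it is `v`; on a glued
stratum it is `v` exactly off the capped tube).  CONSUMER: the `hRest` head `Σ [IsRestShape]·(common shape) = restTarget` (R6 κ-classes LH4-p13 + R7 glue classes LH7-p05 + R8 H
LH7-p08, summed), which after this brick is a sum of per-stratum ★ values.
ED. 2 (append-only, §3): `sum_box_restShape_eq_of_rows` — the glue SOCKET: four per-stratum row letters + ONE arithmetic identity `harith` ⟹ the indicator sum = `R`.
HONEST LABEL.  Count-neutral bookkeeping; R6∕R7∕R8, `hRest`, (T3), `hbox`, (β) are OPEN; `HC_CM` is proved only modulo the 7 printed citations (2 remaining named inputs: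
hLiu418 = `stmt-HodgeConjecture-24832`, h413 = `stmt-HodgeConjecture-24833`) until rung 0 closes.

## References
* [Kottwitz1986BaseChangeUnits] R. E. Kottwitz, *Base change for unit elements of Hecke algebras*, Compositio Math. 60 (1986), §1 pp. 240–241 (lattice counts by strata).
* [Rogawski1990] J. D. Rogawski, *Automorphic Representations of Unitary Groups in Three Variables*, Ann. of Math. Stud. 123 (1990), §4.9 Prop. 4.9.1 (a)(b) p. 55.
-/

set_option autoImplicit false

namespace Summit.HodgeConjecture.HodgeConjecture.Cruxes.H413.F0P3cDyRamOddLabelledRestReindex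

open Finset
open Summit.HodgeConjecture.HodgeConjecture.Cruxes.H413.F0P3cDyRamOddLabelledBoxSumDefs
open Summit.HodgeConjecture.HodgeConjecture.Cruxes.H413.F0P3cDyRamOddLabelledBoxReindex

/-! ## §1  The rest-shape indicator on each shape family -/

/-- The core `![0,0,0]` is not a rest shape. [cite: Kottwitz1986BaseChangeUnits, §1 pp. 240–241] -/
theorem not_isRestShape_core (d n₁ n₂ n₃ : ℕ) : ¬ IsRestShape d n₁ n₂ n₃ ![0, 0, 0] := by
  simp [IsRestShape]

/-- The towers `![0,s,s]`, `![s,0,s]`, `![s,s,0]` are not rest shapes. [cite: Kottwitz1986BaseChangeUnits, §1 pp. 240–241] -/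
theorem not_isRestShape_towers (d n₁ n₂ n₃ s : ℕ) :
    ¬ IsRestShape d n₁ n₂ n₃ ![0, s, s] ∧ ¬ IsRestShape d n₁ n₂ n₃ ![s, 0, s] ∧ ¬ IsRestShape d n₁ n₂ n₃ ![s, s, 0] := by
  refine ⟨?_, ?_, ?_⟩ <;>
  · rintro (⟨h1, h2, h3, h4⟩ | ⟨h1, h2, h3, h4, h5, h6⟩ | ⟨h1, h2, h3, h4, h5, h6⟩ | ⟨h1, h2, h3, h4, h5, h6⟩) <;>
      simp only [Matrix.cons_val_zero, Matrix.cons_val_one, Matrix.cons_val_two, Matrix.tail_cons, Matrix.head_cons] at h1 h2 h3 <;> omega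

/-- The core-hanging vector `![2ρ,2ρ,2ρ]`, `ρ ≥ 1`, IS a rest shape. [cite: Kottwitz1986BaseChangeUnits, §1 pp. 240–241] -/
theorem isRestShape_hanging (d n₁ n₂ n₃ : ℕ) {ρ : ℕ} (hρ : 1 ≤ ρ) : IsRestShape d n₁ n₂ n₃ ![2 * ρ, 2 * ρ, 2 * ρ] :=
  Or.inl ⟨by simp only [Matrix.cons_val_zero, Matrix.cons_val_one], by simp only [Matrix.cons_val_zero, Matrix.cons_val_one, Matrix.cons_val_two, Matrix.tail_cons, Matrix.head_cons], by simp only [Matrix.cons_val_zero]; omega, ⟨ρ, by simp only [Matrix.cons_val_zero]⟩⟩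

/-- The glued vector of tower 1 `![2ρ, 2ρ+s, 2ρ+s]` (`ρ, s ≥ 1`) is a rest shape iff `2 ∣ s` and it is NOT a capped tube class of tower 1.
[cite: Kottwitz1986BaseChangeUnits, §1 pp. 240–241] -/
theorem isRestShape_G1_iff (d n₁ n₂ n₃ : ℕ) {ρ s : ℕ} (hρ : 1 ≤ ρ) (hs : 1 ≤ s) :
    IsRestShape d n₁ n₂ n₃ ![2 * ρ, 2 * ρ + s, 2 * ρ + s] ↔
      2 ∣ s ∧ ¬ (2 * ρ + s + d % 2 = n₁ ∧ 2 * ρ + 2 + d % 2 ≤ min n₂ n₃) := by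
  constructor
  · rintro (⟨h1, -, -, -⟩ | ⟨-, -, -, -, h5, h6⟩ | ⟨h1, -, -, -, -, -⟩ | ⟨h1, h2, -, -, -, -⟩)
    · simp only [Matrix.cons_val_zero, Matrix.cons_val_one] at h1; omega
    · simp only [Matrix.cons_val_zero, Matrix.cons_val_one] at h5 h6
      exact ⟨by omega, h6⟩
    · simp only [Matrix.cons_val_zero, Matrix.cons_val_two, Matrix.tail_cons, Matrix.head_cons] at h1; omega
    · simp only [Matrix.cons_val_zero, Matrix.cons_val_two, Matrix.tail_cons, Matrix.head_cons] at h2; omega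
  · rintro ⟨h2s, hnot⟩
    refine Or.inr (Or.inl ⟨by simp only [Matrix.cons_val_zero, Matrix.cons_val_one, Matrix.cons_val_two, Matrix.tail_cons, Matrix.head_cons], ?_, ?_, ⟨ρ, by simp only [Matrix.cons_val_zero]⟩, ?_, ?_⟩)
    · simp only [Matrix.cons_val_zero, Matrix.cons_val_one]; omega
    · simp only [Matrix.cons_val_zero]; omega
    · simp only [Matrix.cons_val_zero, Matrix.cons_val_one]; omega
    · simpa only [Matrix.cons_val_zero, Matrix.cons_val_one, Matrix.cons_val_two, Matrix.tail_cons, Matrix.head_cons] using hnot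

/-- The glued vector of tower 2 `![2ρ+s, 2ρ, 2ρ+s]` is a rest shape iff `2 ∣ s` and it is NOT a capped tube class of tower 2. [cite: Kottwitz1986BaseChangeUnits, §1 pp. 240–241] -/
theorem isRestShape_G2_iff (d n₁ n₂ n₃ : ℕ) {ρ s : ℕ} (hρ : 1 ≤ ρ) (hs : 1 ≤ s) :
    IsRestShape d n₁ n₂ n₃ ![2 * ρ + s, 2 * ρ, 2 * ρ + s] ↔
      2 ∣ s ∧ ¬ (2 * ρ + s + d % 2 = n₂ ∧ 2 * ρ + 2 + d % 2 ≤ min n₁ n₃) := by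
  constructor
  · rintro (⟨h1, -, -, -⟩ | ⟨h1, -, -, -, -, -⟩ | ⟨-, -, -, -, h5, h6⟩ | ⟨h1, h2, -, -, -, -⟩)
    · simp only [Matrix.cons_val_zero, Matrix.cons_val_one] at h1; omega
    · simp only [Matrix.cons_val_zero, Matrix.cons_val_one, Matrix.cons_val_two, Matrix.tail_cons, Matrix.head_cons] at h1; omega
    · simp only [Matrix.cons_val_zero, Matrix.cons_val_one] at h5 h6
      exact ⟨by omega, h6⟩
    · simp only [Matrix.cons_val_zero, Matrix.cons_val_two, Matrix.tail_cons, Matrix.head_cons] at h2; omega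
  · rintro ⟨h2s, hnot⟩
    refine Or.inr (Or.inr (Or.inl ⟨by simp only [Matrix.cons_val_zero, Matrix.cons_val_two, Matrix.tail_cons, Matrix.head_cons], ?_, ?_, ⟨ρ, by simp only [Matrix.cons_val_zero, Matrix.cons_val_one]⟩, ?_, ?_⟩))
    · simp only [Matrix.cons_val_zero, Matrix.cons_val_one]; omega
    · simp only [Matrix.cons_val_zero, Matrix.cons_val_one]; omega
    · simp only [Matrix.cons_val_zero]; omega
    · simpa only [Matrix.cons_val_zero, Matrix.cons_val_one, Matrix.cons_val_two, Matrix.tail_cons, Matrix.head_cons] using hnot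

/-- The glued vector of tower 3 `![2ρ+s, 2ρ+s, 2ρ]` is a rest shape iff `2 ∣ s` and it is NOT a capped tube class of tower 3. [cite: Kottwitz1986BaseChangeUnits, §1 pp. 240–241] -/
theorem isRestShape_G3_iff (d n₁ n₂ n₃ : ℕ) {ρ s : ℕ} (hρ : 1 ≤ ρ) (hs : 1 ≤ s) :
    IsRestShape d n₁ n₂ n₃ ![2 * ρ + s, 2 * ρ + s, 2 * ρ] ↔
      2 ∣ s ∧ ¬ (2 * ρ + s + d % 2 = n₃ ∧ 2 * ρ + 2 + d % 2 ≤ min n₁ n₂) := by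
  constructor
  · rintro (⟨-, h2, -, -⟩ | ⟨h1, -, -, -, -, -⟩ | ⟨h1, h2, -, -, -, -⟩ | ⟨-, -, -, -, h5, h6⟩)
    · simp only [Matrix.cons_val_zero, Matrix.cons_val_one, Matrix.cons_val_two, Matrix.tail_cons, Matrix.head_cons] at h2; omega
    · simp only [Matrix.cons_val_zero, Matrix.cons_val_one, Matrix.cons_val_two, Matrix.tail_cons, Matrix.head_cons] at h1; omega
    · simp only [Matrix.cons_val_zero, Matrix.cons_val_one] at h2; omega
    · simp only [Matrix.cons_val_zero, Matrix.cons_val_two, Matrix.tail_cons, Matrix.head_cons] at h5 h6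
      exact ⟨by omega, h6⟩
  · rintro ⟨h2s, hnot⟩
    refine Or.inr (Or.inr (Or.inr ⟨by simp only [Matrix.cons_val_zero, Matrix.cons_val_one], ?_, ?_, ⟨ρ, by simp only [Matrix.cons_val_two, Matrix.tail_cons, Matrix.head_cons]⟩, ?_, ?_⟩))
    · simp only [Matrix.cons_val_zero, Matrix.cons_val_two, Matrix.tail_cons, Matrix.head_cons]; omega
    · simp only [Matrix.cons_val_two, Matrix.tail_cons, Matrix.head_cons]; omega
    · simp only [Matrix.cons_val_zero]; omega
    · simpa only [Matrix.cons_val_zero, Matrix.cons_val_one, Matrix.cons_val_two, Matrix.tail_cons, Matrix.head_cons] using hnot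

/-- A rest shape lies inside the ★ B3 shape list (hanging with `ρ ≥ 1`, or glued with `ρ ≥ 1`, `2 ∣ s`, `2 ≤ s`). [cite: Kottwitz1986BaseChangeUnits, §1 pp. 240–241] -/
theorem shape_of_isRestShape (d n₁ n₂ n₃ : ℕ) {a : Fin 3 → ℕ} (ha : IsRestShape d n₁ n₂ n₃ a) :
    (a = ![0, 0, 0]) ∨
      (∃ s, 2 ∣ s ∧ 2 ≤ s ∧ (a = ![0, s, s] ∨ a = ![s, 0, s] ∨ a = ![s, s, 0])) ∨
      (∃ ρ s, 1 ≤ ρ ∧ 2 ∣ s ∧ 2 ≤ s ∧ (a = ![2 * ρ, 2 * ρ + s, 2 * ρ + s] ∨ a = ![2 * ρ + s, 2 * ρ, 2 * ρ + s] ∨ a = ![2 * ρ + s, 2 * ρ + s, 2 * ρ])) ∨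
      (∃ ρ, 1 ≤ ρ ∧ a = ![2 * ρ, 2 * ρ, 2 * ρ]) := by
  rcases ha with ⟨h1, h2, h3, ⟨ρ, hρ⟩⟩ | ⟨h1, h2, h3, ⟨ρ, hρ⟩, ⟨σ₁, hσ₁⟩, -⟩ | ⟨h1, h2, h3, ⟨ρ, hρ⟩, ⟨σ₁, hσ₁⟩, -⟩ |
    ⟨h1, h2, h3, ⟨ρ, hρ⟩, ⟨σ₁, hσ₁⟩, -⟩
  · refine Or.inr (Or.inr (Or.inr ⟨ρ, by omega, ?_⟩))
    funext j; fin_cases j <;> simp <;> omega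
  · refine Or.inr (Or.inr (Or.inl ⟨ρ, a 1 - a 0, by omega, ⟨σ₁ - ρ, by omega⟩, by omega, Or.inl ?_⟩))
    funext j; fin_cases j <;> simp <;> omega
  · refine Or.inr (Or.inr (Or.inl ⟨ρ, a 0 - a 1, by omega, ⟨σ₁ - ρ, by omega⟩, by omega, Or.inr (Or.inl ?_)⟩))
    funext j; fin_cases j <;> simp <;> omega
  · refine Or.inr (Or.inr (Or.inl ⟨ρ, a 0 - a 2, by omega, ⟨σ₁ - ρ, by omega⟩, by omega, Or.inr (Or.inr ?_)⟩))
    funext j; fin_cases j <;> simp <;> omega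

/-! ## §2  The re-indexing of the rest-shape sum -/

/-- **THE REST-SHAPE SUM RE-INDEXED**: for any weight `v` on axis vectors and any box `B`,
`Σ_{a ∈ [0,B]³} [IsRestShape d n₁ n₂ n₃ a]·v a = Σ_{ρ ∈ Icc 1 (B∕2)} v ![2ρ,2ρ,2ρ] + Σ_{ρ ∈ Icc 1 (B∕2)} Σ_{s ∈ Icc 1 (B − 2ρ)} (three glued families cut by 2 ∣ s ∧ ¬ capped-tube)`
(★ p861221 at the weight `[IsRestShape]·v`). [cite: Kottwitz1986BaseChangeUnits, §1 pp. 240–241] [cite: Rogawski1990, §4.9 Prop. 4.9.1 (a)(b) p. 55] -/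
theorem sum_box_restShape_eq (B d n₁ n₂ n₃ : ℕ) (v : (Fin 3 → ℕ) → ℚ) :
    ∑ a : Fin 3 → Fin (B + 1), (if IsRestShape d n₁ n₂ n₃ (fun j => (a j : ℕ)) then v (fun j => (a j : ℕ)) else 0) =
      ∑ ρ ∈ Icc 1 (B / 2), v ![2 * ρ, 2 * ρ, 2 * ρ]
      + ∑ ρ ∈ Icc 1 (B / 2), ∑ s ∈ Icc 1 (B - 2 * ρ),
          ((if 2 ∣ s ∧ ¬ (2 * ρ + s + d % 2 = n₁ ∧ 2 * ρ + 2 + d % 2 ≤ min n₂ n₃) then v ![2 * ρ, 2 * ρ + s, 2 * ρ + s] else 0)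
          + (if 2 ∣ s ∧ ¬ (2 * ρ + s + d % 2 = n₂ ∧ 2 * ρ + 2 + d % 2 ≤ min n₁ n₃) then v ![2 * ρ + s, 2 * ρ, 2 * ρ + s] else 0)
          + (if 2 ∣ s ∧ ¬ (2 * ρ + s + d % 2 = n₃ ∧ 2 * ρ + 2 + d % 2 ≤ min n₁ n₂) then v ![2 * ρ + s, 2 * ρ + s, 2 * ρ] else 0)) := by
  classical
  set w : (Fin 3 → ℕ) → ℚ := fun a => if IsRestShape d n₁ n₂ n₃ a then v a else 0 with hw
  have hzero : ∀ a : Fin 3 → ℕ, ¬ ((a = ![0, 0, 0]) ∨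
      (∃ s, 2 ∣ s ∧ 2 ≤ s ∧ (a = ![0, s, s] ∨ a = ![s, 0, s] ∨ a = ![s, s, 0])) ∨
      (∃ ρ s, 1 ≤ ρ ∧ 2 ∣ s ∧ 2 ≤ s ∧ (a = ![2 * ρ, 2 * ρ + s, 2 * ρ + s] ∨ a = ![2 * ρ + s, 2 * ρ, 2 * ρ + s] ∨ a = ![2 * ρ + s, 2 * ρ + s, 2 * ρ])) ∨
      (∃ ρ, 1 ≤ ρ ∧ a = ![2 * ρ, 2 * ρ, 2 * ρ])) → w a = 0 := by
    intro a ha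
    simp only [hw]
    rw [if_neg]
    exact fun hr => ha (shape_of_isRestShape d n₁ n₂ n₃ hr)
  have h := sum_box_eq_core_add_hanging_add_towers_add_glued B w hzero
  simp only [hw] at h
  rw [h, if_neg (not_isRestShape_core d n₁ n₂ n₃)]
  have hT : ∀ s, (if IsRestShape d n₁ n₂ n₃ ![0, s, s] then v ![0, s, s] else 0) + (if IsRestShape d n₁ n₂ n₃ ![s, 0, s] then v ![s, 0, s] else 0)
      + (if IsRestShape d n₁ n₂ n₃ ![s, s, 0] then v ![s, s, 0] else 0) = 0 := by
    intro s
    obtain ⟨h1, h2, h3⟩ := not_isRestShape_towers d n₁ n₂ n₃ s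
    rw [if_neg h1, if_neg h2, if_neg h3]; ring
  simp only [hT, Finset.sum_const_zero, add_zero, zero_add]
  congr 1
  · refine Finset.sum_congr rfl fun ρ hρ => ?_
    rw [Finset.mem_Icc] at hρ
    rw [if_pos (isRestShape_hanging d n₁ n₂ n₃ hρ.1)]
  · refine Finset.sum_congr rfl fun ρ hρ => Finset.sum_congr rfl fun s hs => ?_
    rw [Finset.mem_Icc] at hρ hs
    rw [if_congr (isRestShape_G1_iff d n₁ n₂ n₃ hρ.1 hs.1) rfl rfl, if_congr (isRestShape_G2_iff d n₁ n₂ n₃ hρ.1 hs.1) rfl rfl,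
      if_congr (isRestShape_G3_iff d n₁ n₂ n₃ hρ.1 hs.1) rfl rfl]

/-! ## §3  ED. 2 (append-only): the glue socket — the rest-shape sum from per-stratum ROW LETTERS and ONE arithmetic identity -/

/-- **THE `hRest` GLUE SOCKET (pure `ℚ`).**  If the weight `v` takes the values `VH ρ` on the core-hanging vectors `![2ρ,2ρ,2ρ]` (`1 ≤ ρ`, `2ρ ≤ B`) and `VG X ρ s` on the
NON-TUBE glued vectors of tower `X` (`1 ≤ ρ`, `1 ≤ s`, `2ρ + s ≤ B`, `2 ∣ s`, NOT a capped tube class) — these are the β-BOARD rows R8 (H) and R6 ∕ R7 ∕ zero cells per tower, in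
closed form — and the closed forms satisfy the ONE arithmetic identity `harith` (hanging line + three cut double sums `= R`), then the rest-shape indicator sum equals `R`.  With
`v :=` the board's common shape, `R := restTarget …` this IS the trunk's `hRest` letter (★ p861403); the lattice content is in the four row hypotheses, the q-arithmetic in `harith`.
[cite: Kottwitz1986BaseChangeUnits, §1 pp. 240–241] [cite: Rogawski1990, §4.9 Prop. 4.9.1 (a)(b) p. 55] -/
theorem sum_box_restShape_eq_of_rows (B d n₁ n₂ n₃ : ℕ) (v : (Fin 3 → ℕ) → ℚ) (VH : ℕ → ℚ) (VG : Fin 3 → ℕ → ℕ → ℚ) (R : ℚ)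
    (hH : ∀ ρ, 1 ≤ ρ → 2 * ρ ≤ B → v ![2 * ρ, 2 * ρ, 2 * ρ] = VH ρ)
    (hG1 : ∀ ρ s, 1 ≤ ρ → 1 ≤ s → 2 * ρ + s ≤ B → 2 ∣ s → ¬ (2 * ρ + s + d % 2 = n₁ ∧ 2 * ρ + 2 + d % 2 ≤ min n₂ n₃) →
      v ![2 * ρ, 2 * ρ + s, 2 * ρ + s] = VG 0 ρ s)
    (hG2 : ∀ ρ s, 1 ≤ ρ → 1 ≤ s → 2 * ρ + s ≤ B → 2 ∣ s → ¬ (2 * ρ + s + d % 2 = n₂ ∧ 2 * ρ + 2 + d % 2 ≤ min n₁ n₃) →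
      v ![2 * ρ + s, 2 * ρ, 2 * ρ + s] = VG 1 ρ s)
    (hG3 : ∀ ρ s, 1 ≤ ρ → 1 ≤ s → 2 * ρ + s ≤ B → 2 ∣ s → ¬ (2 * ρ + s + d % 2 = n₃ ∧ 2 * ρ + 2 + d % 2 ≤ min n₁ n₂) →
      v ![2 * ρ + s, 2 * ρ + s, 2 * ρ] = VG 2 ρ s)
    (harith : ∑ ρ ∈ Icc 1 (B / 2), VH ρ
      + ∑ ρ ∈ Icc 1 (B / 2), ∑ s ∈ Icc 1 (B - 2 * ρ),
          ((if 2 ∣ s ∧ ¬ (2 * ρ + s + d % 2 = n₁ ∧ 2 * ρ + 2 + d % 2 ≤ min n₂ n₃) then VG 0 ρ s else 0)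
          + (if 2 ∣ s ∧ ¬ (2 * ρ + s + d % 2 = n₂ ∧ 2 * ρ + 2 + d % 2 ≤ min n₁ n₃) then VG 1 ρ s else 0)
          + (if 2 ∣ s ∧ ¬ (2 * ρ + s + d % 2 = n₃ ∧ 2 * ρ + 2 + d % 2 ≤ min n₁ n₂) then VG 2 ρ s else 0)) = R) :
    ∑ a : Fin 3 → Fin (B + 1), (if IsRestShape d n₁ n₂ n₃ (fun j => (a j : ℕ)) then v (fun j => (a j : ℕ)) else 0) = R := by
  classical
  rw [sum_box_restShape_eq, ← harith]
  congr 1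
  · refine Finset.sum_congr rfl fun ρ hρ => ?_
    rw [Finset.mem_Icc] at hρ
    exact hH ρ hρ.1 (by omega)
  · refine Finset.sum_congr rfl fun ρ hρ => Finset.sum_congr rfl fun s hs => ?_
    rw [Finset.mem_Icc] at hρ hs
    have hB : 2 * ρ + s ≤ B := by omega
    congr 1
    · congr 1
      · split_ifs with hc
        · exact hG1 ρ s hρ.1 hs.1 hB hc.1 hc.2
        · rfl
      · split_ifs with hc
        · exact hG2 ρ s hρ.1 hs.1 hB hc.1 hc.2
        · rfl
    · split_ifs with hc
      · exact hG3 ρ s hρ.1 hs.1 hB hc.1 hc.2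
      · rfl

end Summit.HodgeConjecture.HodgeConjecture.Cruxes.H413.F0P3cDyRamOddLabelledRestReindex
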